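import Mathlib

/-!
# NE7PairwiseMarginal — row NE7 (node U5), route «PAIR-CAUCHY»: the RATE-FREE MARGINAL LEMMA (M♭) — a coupling
# discrepancy PINNED at the unit scale, driven by sources that only TEND TO ZERO with the age of the scale, and fed
# back through a geometric memory with ℓ¹ coefficients, is BOUNDED and TENDS TO ZERO scale by scale

Cell `pub-balaban`, rung (B)+1 sub-cell t4, lineage `b2b-balaban-t4-ne7-p2` (CRUX PROVER NE7 #2 under the coordinator
ruling «YM redirect», 2026-08-21; generation 48; route text `HOME/t4/b2b-balaban-t4-ne7-p2/g48/ROUTE2-NE7-P2.md` §2 (M♭)).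
HONEST FRAMING (page 1): FIXED FINITE T⁴, rung (B)+1 = existence AND uniqueness of the `ε = L^{−K} → 0` limit of
unit-scale averaged expectations, CONDITIONAL on BetaPertH and the nine spine estimates (0/9 proved); NOT infinite
volume, NOT a mass gap, NOT the Clay problem.  NE7 is NOT PRINTED in [Balaban1984PropagatorsI]–[Balaban1989LargeFieldII]
and NOT proved here.  Everything below is [folklore] real analysis on HYPOTHESIS SHAPES (abstract double sequences of
reals); no definition, no cite tag, nothing printed asserted, no `sorry`.

WHY.  On the route «PAIR-CAUCHY» (`Support/NE7PairwiseCauchy`: node U6 from a PAIRWISE comparison of the runs of `K` and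
`K′ ≥ K` steps with a remainder that only tends to zero) the one channel that does not contract is the MARGINAL one: the
coupling.  In the coordinate `x = 1∕g²` both runs are PINNED at the unit scale (`T4Continuum.FiniteEpsData.Tuned`: the
tuned runs end at the same renormalised coupling), the discrepancy `d K m` at block scale `m` (counted from the unit
scale, `m ≤ K`) is the sum of the `m` increments of the two runs' β-functions between the unit scale and `m` — transported
with factor `1`, not damped ([GawedzkiKupiainen1985] (143), tree `T4BetaMemory`) — and each increment is bounded by a
SOURCE `s K m′` (the flat η-defect of the one-loop coefficient at age `K − m′` plus the history terms of the irrelevant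
discrepancies, both → 0 as `K → ∞` at fixed `m′` on this route, and bounded) plus a FEEDBACK
`c m′ · Σ_{n≥0} ν^{n+1} · d K (m′+n+1)`: the β-remainder at scale `m′` depends on the couplings at the finer scales
`m′+n+1` through the history channel with geometric memory `ν < 1` (row NE4's transfer model, `NE4TransferModel`; row
NE9's `FadingMemory`) and a coupling-Lipschitz coefficient `c m′` which, in the `x`-coordinate, carries the weight `g_{m′}⁴`
(`δg = g³δx∕2`, the remainder Lipschitz in `g` — [Balaban1987RG1] p. 263 «C^∞ (or analytic) in g_{j−1}» is the located
one-run regularity; a hypothesis shape here), so that `Σ_{m′} c m′ ≲ Σ_m (1∕g² + b·m)^{−2} < ∞` along the asymptotically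
free trajectory: an AF-window `Cc·ν∕(1−ν) ≤ q < 1` in the renormalised coupling replaces row NE4's ε₁-window
`hsmall : ν < θ`.  This file proves the abstract lemma: under exactly these displayed hypotheses the discrepancy is
BOUNDED by `S̄∕(1−q)` at all scales (§2) and TENDS TO ZERO at every fixed scale (§3) — with NO geometric rate on the
sources and NO summability in `K`.  It is the qualitative twin of `T4CouplingMatching.injectedRate_of_runs` ∕
`NE4TransferResolvent.injectedRate_of_model`; the load-bearing structural input is the ℓ¹ bound on the feedback
coefficients (with `c` constant in `m′` the feedback operator has norm `∝ K` and the scheme does not close).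

THE HYPOTHESIS (H), displayed once: for all `K` and all `m ≤ K`,
  `d K m ≤ s K m + Σ_{m′ ≤ m} c m′ · Σ_{n < K − m′} ν^{n+1} · d K (m′+n+1)`.

WHAT IS PROVED ([folklore]).
§1 geometric pieces: `sum_pow_succ_le` (`Σ_{n<R} ν^{n+1} ≤ ν∕(1−ν)`), `sum_pow_succ_shift_le`
   (`Σ_{n<R} ν^{N+n+1} ≤ ν^{N+1}∕(1−ν)`), `inner_sum_le_split` (the memory sum split at depth `N`: finer scales up to
   `M+N` by a bound `X`, the rest by the global bound `B`).
§2 **`marginal_bound`** — (H), `s ≤ S̄`, `0 ≤ d`, `0 ≤ c`, `Σ_{m′≤K} c m′ ≤ Cc`, `Cc·ν∕(1−ν) ≤ q < 1` ⟹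
   `d K m ≤ S̄∕(1−q)` for all `m ≤ K` (finite-dimensional fixed point: the maximum over `m ≤ K` obeys `M ≤ S̄ + qM`).
§3 `sources_eventually_small` (finitely many null sequences are uniformly small beyond some `K₀`), `marginal_step`
   (one turn of the screw: a bound `X` at the scales `≤ M+N` beyond `K₀` gives `s + q·X + T_N` at the scales `≤ M`, with
   the memory tail `T_N = Cc·B·ν^{N+1}∕(1−ν)`), `marginal_iterate` (after `p` turns: `q^p·B + T_N∕(1−q) + ε`), and
   **`marginal_tendsto_zero`** — `∀ m, Tendsto (fun K => d K m) atTop (𝓝 0)`.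
§4 `toy_marginal` — non-vacuity with genuine feedback: `d K m = (m+1)∕(K+1)`-type data satisfy (H) with null sources.

NOT DELIVERED: the instance for Bałaban's β-functions (row NE4's model O1 read in the `x`-coordinate; the `g⁴`-weight of
the coupling-Lipschitz coefficient is a HYPOTHESIS SHAPE here, located but not derived); the sources' null property
(rows NE2∕NE3∕NE5∕NE9 in modulus form + G-an2-4's (CONV-C) as plain convergence).  NOT NE7 (spine 0/9 unchanged), NOT
summit progress.  HONEST DEPENDENCY: continuum YM on T⁴ ⇐ BetaPertH ∧ nine spine estimates (0/9 proved); BetaPertH ⇐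
(D1) ∧ (D4) ∧ CAP+tail; G-an2-4 gates asym, D1 and NE2/3/4.
-/

noncomputable section

open Finset Filter Topology
open scoped BigOperators

namespace Summit.QuantumFields.BalabanUV.T4Continuum.NE7PairwiseMarginal

/-! ## §1 Geometric pieces -/

section Geometric

variable {ν : ℝ}

/-- `Σ_{n<R} ν^{n+1} ≤ ν∕(1−ν)` for `0 ≤ ν < 1`. [folklore] -/
theorem sum_pow_succ_le (hν0 : 0 ≤ ν) (hν1 : ν < 1) (R : ℕ) :
    ∑ n ∈ range R, ν ^ (n + 1) ≤ ν / (1 - ν) := by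
  have hs := summable_geometric_of_lt_one hν0 hν1
  have h1 : ∑ n ∈ range R, ν ^ n ≤ (1 - ν)⁻¹ := by
    rw [← tsum_geometric_of_lt_one hν0 hν1]
    exact hs.sum_le_tsum _ fun i _ => pow_nonneg hν0 i
  calc ∑ n ∈ range R, ν ^ (n + 1) = ν * ∑ n ∈ range R, ν ^ n := by
        rw [mul_sum]; exact sum_congr rfl fun n _ => by ring
    _ ≤ ν * (1 - ν)⁻¹ := mul_le_mul_of_nonneg_left h1 hν0
    _ = ν / (1 - ν) := by rw [div_eq_mul_inv]

/-- `Σ_{n<R} ν^{N+n+1} ≤ ν^{N+1}∕(1−ν)` for `0 ≤ ν < 1`. [folklore] -/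
theorem sum_pow_succ_shift_le (hν0 : 0 ≤ ν) (hν1 : ν < 1) (N R : ℕ) :
    ∑ n ∈ range R, ν ^ (N + n + 1) ≤ ν ^ (N + 1) / (1 - ν) := by
  have hs := summable_geometric_of_lt_one hν0 hν1
  have h1 : ∑ n ∈ range R, ν ^ n ≤ (1 - ν)⁻¹ := by
    rw [← tsum_geometric_of_lt_one hν0 hν1]
    exact hs.sum_le_tsum _ fun i _ => pow_nonneg hν0 i
  calc ∑ n ∈ range R, ν ^ (N + n + 1) = ν ^ (N + 1) * ∑ n ∈ range R, ν ^ n := by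
        rw [mul_sum]; exact sum_congr rfl fun n _ => by ring
    _ ≤ ν ^ (N + 1) * (1 - ν)⁻¹ := mul_le_mul_of_nonneg_left h1 (pow_nonneg hν0 _)
    _ = ν ^ (N + 1) / (1 - ν) := by rw [div_eq_mul_inv]

/-- **THE MEMORY SUM SPLIT AT DEPTH `N`.**  If the discrepancies at the scales `≤ M + N` are `≤ X` and all scales `≤ K`
are `≤ B` (`X, B ≥ 0`), then for `m′ ≤ M` the memory sum `Σ_{n < K−m′} ν^{n+1} d K (m′+n+1)` is at most
`ν∕(1−ν)·X + ν^{N+1}∕(1−ν)·B`. [folklore] -/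
theorem inner_sum_le_split (hν0 : 0 ≤ ν) (hν1 : ν < 1) {d : ℕ → ℕ → ℝ} {K M N m' : ℕ} {X B : ℝ} (hX0 : 0 ≤ X)
    (hB0 : 0 ≤ B) (hm' : m' ≤ M) (hX : ∀ j, j ≤ M + N → d K j ≤ X) (hB : ∀ j, j ≤ K → d K j ≤ B) :
    ∑ n ∈ range (K - m'), ν ^ (n + 1) * d K (m' + n + 1) ≤ ν / (1 - ν) * X + ν ^ (N + 1) / (1 - ν) * B := by
  have h1ν : 0 < 1 - ν := by linarith
  by_cases hN : N ≤ K - m'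
  · -- split the range at `N`
    rw [← sum_range_add_sum_Ico _ hN]
    have hfirst : ∑ n ∈ range N, ν ^ (n + 1) * d K (m' + n + 1) ≤ ν / (1 - ν) * X := by
      calc ∑ n ∈ range N, ν ^ (n + 1) * d K (m' + n + 1) ≤ ∑ n ∈ range N, ν ^ (n + 1) * X := by
            refine sum_le_sum fun n hn => ?_
            have hn' := mem_range.1 hn
            exact mul_le_mul_of_nonneg_left (hX _ (by omega)) (pow_nonneg hν0 _)
        _ = (∑ n ∈ range N, ν ^ (n + 1)) * X := by rw [sum_mul]
        _ ≤ ν / (1 - ν) * X := mul_le_mul_of_nonneg_right (sum_pow_succ_le hν0 hν1 N) hX0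
    have hsecond : ∑ n ∈ Ico N (K - m'), ν ^ (n + 1) * d K (m' + n + 1) ≤ ν ^ (N + 1) / (1 - ν) * B := by
      rw [sum_Ico_eq_sum_range]
      calc ∑ k ∈ range (K - m' - N), ν ^ (N + k + 1) * d K (m' + (N + k) + 1)
            ≤ ∑ k ∈ range (K - m' - N), ν ^ (N + k + 1) * B := by
            refine sum_le_sum fun k hk => ?_
            have hk' := mem_range.1 hk
            exact mul_le_mul_of_nonneg_left (hB _ (by omega)) (pow_nonneg hν0 _)
        _ = (∑ k ∈ range (K - m' - N), ν ^ (N + k + 1)) * B := by rw [sum_mul]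
        _ ≤ ν ^ (N + 1) / (1 - ν) * B :=
            mul_le_mul_of_nonneg_right (sum_pow_succ_shift_le hν0 hν1 N _) hB0
    linarith
  · -- the whole range lies below `N`: only the first piece occurs
    rw [not_le] at hN
    have hfirst : ∑ n ∈ range (K - m'), ν ^ (n + 1) * d K (m' + n + 1) ≤ ν / (1 - ν) * X := by
      calc ∑ n ∈ range (K - m'), ν ^ (n + 1) * d K (m' + n + 1) ≤ ∑ n ∈ range (K - m'), ν ^ (n + 1) * X := by
            refine sum_le_sum fun n hn => ?_
            have hn' := mem_range.1 hn
            exact mul_le_mul_of_nonneg_left (hX _ (by omega)) (pow_nonneg hν0 _)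
        _ = (∑ n ∈ range (K - m'), ν ^ (n + 1)) * X := by rw [sum_mul]
        _ ≤ ν / (1 - ν) * X := mul_le_mul_of_nonneg_right (sum_pow_succ_le hν0 hν1 _) hX0
    have hsecond : 0 ≤ ν ^ (N + 1) / (1 - ν) * B := by positivity
    linarith

end Geometric

/-! ## §2 The uniform bound -/

section Bound

variable {ν Cc q Sbar : ℝ} {c : ℕ → ℝ} {s d : ℕ → ℕ → ℝ}

/-- **THE UNIFORM BOUND.**  Under (H) with sources `s ≤ S̄`, `0 ≤ d`, `0 ≤ c` with partial sums `≤ Cc`, memory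
`0 ≤ ν < 1` and the window `Cc·ν∕(1−ν) ≤ q < 1`: `d K m ≤ S̄∕(1−q)` for every `m ≤ K`.  (The maximum `M` of `d K ·` over
the finitely many scales `≤ K` satisfies `M ≤ S̄ + q·M`.) [folklore] -/
theorem marginal_bound (hν0 : 0 ≤ ν) (hν1 : ν < 1) (hc0 : ∀ m, 0 ≤ c m)
    (hCc : ∀ K, ∑ m ∈ range (K + 1), c m ≤ Cc) (hq : Cc * (ν / (1 - ν)) ≤ q) (hq1 : q < 1)
    (hsB : ∀ K m, s K m ≤ Sbar) (hd0 : ∀ K m, 0 ≤ d K m)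
    (H : ∀ K m, m ≤ K → d K m ≤ s K m +
      ∑ m' ∈ range (m + 1), c m' * ∑ n ∈ range (K - m'), ν ^ (n + 1) * d K (m' + n + 1)) :
    ∀ K m, m ≤ K → d K m ≤ Sbar / (1 - q) := by
  intro K
  have h1ν : 0 < 1 - ν := by linarith
  -- the maximum over the scales `≤ K`
  obtain ⟨m₀, hm₀, hmax⟩ := exists_max_image (range (K + 1)) (d K) ⟨0, by simp⟩
  have hm₀K : m₀ ≤ K := Nat.lt_succ_iff.1 (mem_range.1 hm₀)
  set Mx := d K m₀ with hMx
  have hMx0 : 0 ≤ Mx := hd0 K m₀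
  have hle : ∀ j, j ≤ K → d K j ≤ Mx := fun j hj => hmax j (mem_range.2 (Nat.lt_succ_iff.2 hj))
  -- the fixed-point inequality `Mx ≤ S̄ + q·Mx`
  have hq0 : 0 ≤ q := le_trans (by
    have : 0 ≤ Cc := le_trans (sum_nonneg fun m _ => hc0 m) (hCc 0)
    positivity) hq
  have hfix : Mx ≤ Sbar + q * Mx := by
    have hH := H K m₀ hm₀K
    have hinner : ∀ m' ∈ range (m₀ + 1),
        c m' * ∑ n ∈ range (K - m'), ν ^ (n + 1) * d K (m' + n + 1) ≤ c m' * (ν / (1 - ν) * Mx) := by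
      intro m' hm'
      refine mul_le_mul_of_nonneg_left ?_ (hc0 m')
      calc ∑ n ∈ range (K - m'), ν ^ (n + 1) * d K (m' + n + 1)
          ≤ ∑ n ∈ range (K - m'), ν ^ (n + 1) * Mx := by
            refine sum_le_sum fun n hn => ?_
            have hn' := mem_range.1 hn
            exact mul_le_mul_of_nonneg_left (hle _ (by omega)) (pow_nonneg hν0 _)
        _ = (∑ n ∈ range (K - m'), ν ^ (n + 1)) * Mx := by rw [sum_mul]
        _ ≤ ν / (1 - ν) * Mx := mul_le_mul_of_nonneg_right (sum_pow_succ_le hν0 hν1 _) hMx0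
    have hsum : ∑ m' ∈ range (m₀ + 1), c m' * ∑ n ∈ range (K - m'), ν ^ (n + 1) * d K (m' + n + 1)
        ≤ q * Mx := by
      calc _ ≤ ∑ m' ∈ range (m₀ + 1), c m' * (ν / (1 - ν) * Mx) := sum_le_sum hinner
        _ = (∑ m' ∈ range (m₀ + 1), c m') * (ν / (1 - ν) * Mx) := by rw [sum_mul]
        _ ≤ Cc * (ν / (1 - ν) * Mx) := by
            refine mul_le_mul_of_nonneg_right ?_ (by positivity)
            have hsub : range (m₀ + 1) ⊆ range (K + 1) := range_mono (Nat.succ_le_succ hm₀K)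
            exact le_trans (sum_le_sum_of_subset_of_nonneg hsub fun i _ _ => hc0 i) (hCc K)
        _ = Cc * (ν / (1 - ν)) * Mx := by ring
        _ ≤ q * Mx := mul_le_mul_of_nonneg_right hq hMx0
    linarith [hsB K m₀]
  have hbound : Mx ≤ Sbar / (1 - q) := by
    rw [le_div_iff₀ (by linarith)]
    nlinarith
  intro m hm
  exact (hle m hm).trans hbound

end Bound

/-! ## §3 The discrepancy tends to zero at every fixed scale -/

section Limit

variable {ν Cc q Sbar : ℝ} {c : ℕ → ℝ} {s d : ℕ → ℕ → ℝ}

/-- Finitely many null sequences are uniformly small beyond a common threshold. [folklore] -/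
theorem sources_eventually_small (hs : ∀ m, Tendsto (fun K => s K m) atTop (𝓝 0)) (M : ℕ) {ε : ℝ} (hε : 0 < ε) :
    ∃ K₁ : ℕ, ∀ K, K₁ ≤ K → ∀ m, m ≤ M → s K m ≤ ε := by
  have h : ∀ m ∈ range (M + 1), ∀ᶠ K in atTop, s K m ≤ ε := fun m _ =>
    (hs m).eventually (Iic_mem_nhds hε)
  obtain ⟨K₁, hK₁⟩ := eventually_atTop.1 ((range (M + 1)).eventually_all.2 h)
  exact ⟨K₁, fun K hK m hm => hK₁ K hK m (mem_range.2 (Nat.lt_succ_iff.2 hm))⟩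

/-- **ONE TURN OF THE SCREW.**  If beyond `K₀` the discrepancies at the scales `≤ M + N` are `≤ X` (`X ≥ 0`), then beyond
`max K₀ (M + N)` the discrepancies at the scales `≤ M` are `≤ s K m + q·X + T_N`, `T_N = Cc·ν^{N+1}∕(1−ν)·B`, where
`B = S̄∕(1−q)` is the uniform bound of §2. [folklore] -/
theorem marginal_step (hν0 : 0 ≤ ν) (hν1 : ν < 1) (hc0 : ∀ m, 0 ≤ c m)
    (hCc : ∀ K, ∑ m ∈ range (K + 1), c m ≤ Cc) (hq : Cc * (ν / (1 - ν)) ≤ q) (hq1 : q < 1)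
    (hs0 : ∀ K m, 0 ≤ s K m) (hsB : ∀ K m, s K m ≤ Sbar) (hd0 : ∀ K m, 0 ≤ d K m)
    (H : ∀ K m, m ≤ K → d K m ≤ s K m +
      ∑ m' ∈ range (m + 1), c m' * ∑ n ∈ range (K - m'), ν ^ (n + 1) * d K (m' + n + 1))
    {M N K₀ : ℕ} {X : ℝ} (hX0 : 0 ≤ X) (hX : ∀ K, K₀ ≤ K → ∀ j, j ≤ M + N → d K j ≤ X) :
    ∀ K, max K₀ (M + N) ≤ K → ∀ m, m ≤ M →
      d K m ≤ s K m + q * X + Cc * (ν ^ (N + 1) / (1 - ν)) * (Sbar / (1 - q)) := by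
  intro K hK m hm
  have hK₀ : K₀ ≤ K := le_trans (le_max_left _ _) hK
  have hMK : M + N ≤ K := le_trans (le_max_right _ _) hK
  have h1ν : 0 < 1 - ν := by linarith
  have hCc0 : 0 ≤ Cc := le_trans (sum_nonneg fun m _ => hc0 m) (hCc 0)
  have hq0 : 0 ≤ q := le_trans (by positivity) hq
  set B := Sbar / (1 - q) with hB
  have hS0 : 0 ≤ Sbar := le_trans (hs0 0 0) (hsB 0 0)
  have hB0 : 0 ≤ B := div_nonneg hS0 (by linarith)
  have hBd : ∀ j, j ≤ K → d K j ≤ B := marginal_bound hν0 hν1 hc0 hCc hq hq1 hsB hd0 H K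
  have hH := H K m (by omega)
  have hinner : ∀ m' ∈ range (m + 1),
      c m' * ∑ n ∈ range (K - m'), ν ^ (n + 1) * d K (m' + n + 1)
        ≤ c m' * (ν / (1 - ν) * X + ν ^ (N + 1) / (1 - ν) * B) := by
    intro m' hm'
    have hm'M : m' ≤ M := by have := mem_range.1 hm'; omega
    exact mul_le_mul_of_nonneg_left
      (inner_sum_le_split hν0 hν1 hX0 hB0 hm'M (hX K hK₀) hBd) (hc0 m')
  have hsum : ∑ m' ∈ range (m + 1), c m' * ∑ n ∈ range (K - m'), ν ^ (n + 1) * d K (m' + n + 1)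
      ≤ q * X + Cc * (ν ^ (N + 1) / (1 - ν)) * B := by
    have hY : 0 ≤ ν / (1 - ν) * X + ν ^ (N + 1) / (1 - ν) * B := by positivity
    calc _ ≤ ∑ m' ∈ range (m + 1), c m' * (ν / (1 - ν) * X + ν ^ (N + 1) / (1 - ν) * B) := sum_le_sum hinner
      _ = (∑ m' ∈ range (m + 1), c m') * (ν / (1 - ν) * X + ν ^ (N + 1) / (1 - ν) * B) := by rw [sum_mul]
      _ ≤ Cc * (ν / (1 - ν) * X + ν ^ (N + 1) / (1 - ν) * B) := by
          refine mul_le_mul_of_nonneg_right ?_ hY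
          have hmK : m ≤ K := le_trans hm (le_trans (Nat.le_add_right M N) hMK)
          have hsub : range (m + 1) ⊆ range (K + 1) := range_mono (Nat.succ_le_succ hmK)
          exact le_trans (sum_le_sum_of_subset_of_nonneg hsub fun i _ _ => hc0 i) (hCc K)
      _ = Cc * (ν / (1 - ν)) * X + Cc * (ν ^ (N + 1) / (1 - ν)) * B := by ring
      _ ≤ q * X + Cc * (ν ^ (N + 1) / (1 - ν)) * B := by
          have := mul_le_mul_of_nonneg_right hq hX0
          linarith
  linarith

/-- **AFTER `p` TURNS.**  For every depth `N`, every number of turns `p`, every top scale `M` and every `ε > 0` there is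
`K₀` beyond which `d K m ≤ q^p·B + T_N·Σ_{i<p} q^i + ε` for all `m ≤ M` (`B = S̄∕(1−q)`, `T_N = Cc·ν^{N+1}∕(1−ν)·B`).
Induction on `p`, the sources being uniformly small on the finitely many scales involved. [folklore] -/
theorem marginal_iterate (hν0 : 0 ≤ ν) (hν1 : ν < 1) (hc0 : ∀ m, 0 ≤ c m)
    (hCc : ∀ K, ∑ m ∈ range (K + 1), c m ≤ Cc) (hq : Cc * (ν / (1 - ν)) ≤ q) (hq1 : q < 1)
    (hs0 : ∀ K m, 0 ≤ s K m) (hsB : ∀ K m, s K m ≤ Sbar) (hs : ∀ m, Tendsto (fun K => s K m) atTop (𝓝 0))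
    (hd0 : ∀ K m, 0 ≤ d K m)
    (H : ∀ K m, m ≤ K → d K m ≤ s K m +
      ∑ m' ∈ range (m + 1), c m' * ∑ n ∈ range (K - m'), ν ^ (n + 1) * d K (m' + n + 1))
    (N p : ℕ) : ∀ (M : ℕ) (ε : ℝ), 0 < ε → ∃ K₀ : ℕ, ∀ K, K₀ ≤ K → ∀ m, m ≤ M →
      d K m ≤ q ^ p * (Sbar / (1 - q)) + Cc * (ν ^ (N + 1) / (1 - ν)) * (Sbar / (1 - q)) * ∑ i ∈ range p, q ^ i + ε := by
  have h1ν : 0 < 1 - ν := by linarith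
  have hCc0 : 0 ≤ Cc := le_trans (sum_nonneg fun m _ => hc0 m) (hCc 0)
  have hq0 : 0 ≤ q := le_trans (by positivity) hq
  have hS0 : 0 ≤ Sbar := le_trans (hs0 0 0) (hsB 0 0)
  set B := Sbar / (1 - q) with hB
  have hB0 : 0 ≤ B := div_nonneg hS0 (by linarith)
  set T := Cc * (ν ^ (N + 1) / (1 - ν)) * B with hT
  have hT0 : 0 ≤ T := by positivity
  induction p with
  | zero =>
      intro M ε hε
      refine ⟨M, fun K hK m hm => ?_⟩
      have hb := marginal_bound hν0 hν1 hc0 hCc hq hq1 hsB hd0 H K m (by omega)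
      simp only [pow_zero, one_mul, sum_range_zero, mul_zero, add_zero]
      linarith
  | succ p ih =>
      intro M ε hε
      -- previous turn at the scales `≤ M + N` with `ε∕2`, sources `≤ ε∕2` at the scales `≤ M`
      obtain ⟨K₀, hK₀⟩ := ih (M + N) (ε / 2) (by linarith)
      obtain ⟨K₁, hK₁⟩ := sources_eventually_small hs M (half_pos hε)
      set X := q ^ p * B + T * ∑ i ∈ range p, q ^ i + ε / 2 with hX
      have hX0 : 0 ≤ X := by
        have : 0 ≤ ∑ i ∈ range p, q ^ i := sum_nonneg fun i _ => pow_nonneg hq0 i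
        positivity
      have hstep := marginal_step hν0 hν1 hc0 hCc hq hq1 hs0 hsB hd0 H (M := M) (N := N) (K₀ := K₀) hX0 hK₀
      refine ⟨max (max K₀ (M + N)) K₁, fun K hK m hm => ?_⟩
      have hKa : max K₀ (M + N) ≤ K := le_trans (le_max_left _ _) hK
      have hKb : K₁ ≤ K := le_trans (le_max_right _ _) hK
      have h1 := hstep K hKa m hm
      have h2 := hK₁ K hKb m hm
      -- `s + q·X + T ≤ ε∕2 + q^{p+1}B + T·(q·Σ_{i<p} q^i + 1) + q·ε∕2 ≤ goal`
      have e : q * X + T = q ^ (p + 1) * B + T * ∑ i ∈ range (p + 1), q ^ i + q * (ε / 2) := by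
        rw [hX, sum_range_succ_comm, pow_succ]
        have : T * (q ^ p + ∑ x ∈ range p, q ^ x) = T * q ^ p + T * ∑ x ∈ range p, q ^ x := by ring
        rw [this, mul_sum]
        have e2 : q * (T * ∑ i ∈ range p, q ^ i) = T * ∑ i ∈ range p, q ^ (i + 1) := by
          rw [mul_sum, mul_sum, mul_sum]
          exact sum_congr rfl fun i _ => by ring
        have e3 : ∑ x ∈ range p, T * q ^ x = T * ∑ x ∈ range p, q ^ x := by rw [mul_sum]
        rw [e3]
        -- both sides are polynomials in the partial geometric sums; compare via `sum_range_succ'`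
        have e4 : T * q ^ p + T * ∑ x ∈ range p, q ^ x = T * ∑ x ∈ range (p + 1), q ^ x := by
          rw [sum_range_succ]; ring
        have e5 : q * (T * ∑ i ∈ range p, q ^ i) + T = T * ∑ x ∈ range (p + 1), q ^ x := by
          rw [e2, sum_range_succ', pow_zero]
          ring
        nlinarith [e4, e5]
      have hqε : q * (ε / 2) ≤ ε / 2 := by nlinarith
      nlinarith [h1, h2, e, hqε]

/-- **THE DISCREPANCY TENDS TO ZERO AT EVERY FIXED SCALE.**  Under (H), bounded nonnegative sources tending to zero at
every fixed scale, nonnegative discrepancies, nonnegative feedback coefficients with partial sums `≤ Cc`, memory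
`0 ≤ ν < 1` and the window `Cc·ν∕(1−ν) ≤ q < 1`: `d K m → 0` as `K → ∞`, for every `m`.  No rate on the sources, no
summability in `K`. [folklore] -/
theorem marginal_tendsto_zero (hν0 : 0 ≤ ν) (hν1 : ν < 1) (hc0 : ∀ m, 0 ≤ c m)
    (hCc : ∀ K, ∑ m ∈ range (K + 1), c m ≤ Cc) (hq : Cc * (ν / (1 - ν)) ≤ q) (hq1 : q < 1)
    (hs0 : ∀ K m, 0 ≤ s K m) (hsB : ∀ K m, s K m ≤ Sbar) (hs : ∀ m, Tendsto (fun K => s K m) atTop (𝓝 0))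
    (hd0 : ∀ K m, 0 ≤ d K m)
    (H : ∀ K m, m ≤ K → d K m ≤ s K m +
      ∑ m' ∈ range (m + 1), c m' * ∑ n ∈ range (K - m'), ν ^ (n + 1) * d K (m' + n + 1)) :
    ∀ m, Tendsto (fun K => d K m) atTop (𝓝 0) := by
  intro m
  have h1ν : 0 < 1 - ν := by linarith
  have hCc0 : 0 ≤ Cc := le_trans (sum_nonneg fun m _ => hc0 m) (hCc 0)
  have hq0 : 0 ≤ q := le_trans (by positivity) hq
  have hS0 : 0 ≤ Sbar := le_trans (hs0 0 0) (hsB 0 0)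
  set B := Sbar / (1 - q) with hB
  have hB0 : 0 ≤ B := div_nonneg hS0 (by linarith)
  rw [Metric.tendsto_atTop]
  intro ε hε
  -- choose the depth `N` (memory tail), then the number of turns `p` (contraction), then `K₀`
  have hgeom : ∀ p, ∑ i ∈ range p, q ^ i ≤ (1 - q)⁻¹ := fun p => by
    rw [← tsum_geometric_of_lt_one hq0 hq1]
    exact (summable_geometric_of_lt_one hq0 hq1).sum_le_tsum _ fun i _ => pow_nonneg hq0 i
  -- `ν^{N+1} → 0`
  have hνN : Tendsto (fun N : ℕ => Cc * (ν ^ (N + 1) / (1 - ν)) * B * (1 - q)⁻¹) atTop (𝓝 0) := by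
    have h := (tendsto_pow_atTop_nhds_zero_of_lt_one hν0 hν1).comp (tendsto_add_atTop_nat 1)
    have : Tendsto (fun N : ℕ => Cc * (ν ^ (N + 1) / (1 - ν)) * B * (1 - q)⁻¹) atTop
        (𝓝 (Cc * (0 / (1 - ν)) * B * (1 - q)⁻¹)) :=
      ((((h.div_const (1 - ν)).const_mul Cc).mul_const B).mul_const (1 - q)⁻¹)
    simpa using this
  obtain ⟨N, hN⟩ := (Metric.tendsto_atTop.1 hνN) (ε / 4) (by linarith)
  have hN' := hN N le_rfl
  rw [Real.dist_eq, sub_zero, abs_of_nonneg (by positivity)] at hN'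
  -- `q^p → 0`
  have hqp : Tendsto (fun p : ℕ => q ^ p * B) atTop (𝓝 0) := by
    simpa using (tendsto_pow_atTop_nhds_zero_of_lt_one hq0 hq1).mul_const B
  obtain ⟨p, hp⟩ := (Metric.tendsto_atTop.1 hqp) (ε / 4) (by linarith)
  have hp' := hp p le_rfl
  rw [Real.dist_eq, sub_zero, abs_of_nonneg (by positivity)] at hp'
  obtain ⟨K₀, hK₀⟩ := marginal_iterate hν0 hν1 hc0 hCc hq hq1 hs0 hsB hs hd0 H N p m (ε / 4) (by linarith)
  refine ⟨K₀, fun K hK => ?_⟩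
  have h := hK₀ K hK m le_rfl
  rw [Real.dist_eq, sub_zero, abs_of_nonneg (hd0 K m)]
  have hTsum : Cc * (ν ^ (N + 1) / (1 - ν)) * (Sbar / (1 - q)) * ∑ i ∈ range p, q ^ i
      ≤ Cc * (ν ^ (N + 1) / (1 - ν)) * B * (1 - q)⁻¹ :=
    mul_le_mul_of_nonneg_left (hgeom p) (by positivity)
  linarith

end Limit

/-! ## §4 Non-vacuity with genuine feedback -/

section Toy

/-- With `ν = 1∕2`, `c ≡ 0` except `c 0 = 1∕4` (so `Cc = 1∕4`, `q = 1∕4`), sources `s K m = 1∕(K+1)` (null, bounded by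
`1`) and discrepancies `d K m = 1∕(K+1)`, hypothesis (H) holds with a non-zero feedback term, and the conclusion
`d K m → 0` is visible. [folklore] -/
theorem toy_marginal :
    let ν : ℝ := 1 / 2
    let c : ℕ → ℝ := fun m => if m = 0 then 1 / 4 else 0
    let s : ℕ → ℕ → ℝ := fun K _ => 1 / (K + 1)
    let d : ℕ → ℕ → ℝ := fun K _ => 1 / (K + 1)
    (∀ K m, m ≤ K → d K m ≤ s K m +
      ∑ m' ∈ range (m + 1), c m' * ∑ n ∈ range (K - m'), ν ^ (n + 1) * d K (m' + n + 1)) ∧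
    (∀ K, ∑ m ∈ range (K + 1), c m ≤ 1 / 4) ∧ (1 / 4 : ℝ) * ((1 / 2) / (1 - 1 / 2)) ≤ 1 / 4 ∧
    (∀ m, Tendsto (fun K => d K m) atTop (𝓝 0)) := by
  intro ν c s d
  refine ⟨?_, ?_, by norm_num, fun m => tendsto_one_div_add_atTop_nhds_zero_nat⟩
  · intro K m hm
    have hfeed : 0 ≤ ∑ m' ∈ range (m + 1), c m' * ∑ n ∈ range (K - m'), ν ^ (n + 1) * d K (m' + n + 1) := by
      refine sum_nonneg fun m' _ => mul_nonneg ?_ (sum_nonneg fun n _ => mul_nonneg ?_ ?_)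
      · simp only [c]; split_ifs <;> norm_num
      · simp only [ν]; positivity
      · simp only [d]; positivity
    simp only [s, d] at hfeed ⊢
    linarith
  · intro K
    rw [sum_eq_single_of_mem 0 (by simp) (fun m _ hm => by simp [c, hm])]
    simp [c]

end Toy

end Summit.QuantumFields.BalabanUV.T4Continuum.NE7PairwiseMarginal
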